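import Mathlib
import Summits.MatrixMultiplication.MatrixMultiplication.Theses.SnSubsetDichotomy
import Literature.Combinatorics.Additive.TPPGroupAlgebra
import Summits.MatrixMultiplication.MatrixMultiplication.Theorems.SnSubsetDichotomyJuntaBranchStubCash

/-!
# Skeleton — crux `JuntaBranch` (stmt-MatrixMultiplication-8304), line `Sketch` (card `alignment-trichotomy`)

Lead c2's OWNED skeleton of the line `Sketch` (= `Cruxes/JuntaBranch/SketchIdeator5.lean`, round-2
ideator 5).  The ideator's file states the composition `juntaBranch_of_alignedOrAbsent` as a `Prop`
only; here it is PROVED (`JuntaBranch_of`), over the route's inline umvirate notation (no line-local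
definition), from ONE registered stub:

* `stub_alignedOrAbsent` — the card's transfer target `C⁺ = AlignedOrAbsent`, first-set form:
  for all `ε, c > 0`, eventually, in every Large(`c`) TPP triple `S, T, U ⊆ S_n`, every
  `ε`-super-neutral block `(I → L)` of `S` at a level `1 ≤ t ≤ √n` is CASHABLE AT ITS OWN TARGET:
  there are injective partner sources `J, P` with
  `e^{c+1} · |S||T||U| · ((n-t)!/n!)^{3/2} ≤ |S ∩ U_{I→L}| · |T ∩ U_{J→L}| · |U ∩ U_{P→L}|`.
  (The card's `Aligned` quantifies over the three rotations `(S,T,U), (T,U,S), (U,S,T)`; since the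
  outer quantifier ranges over all TPP triples, the TPP is rotation invariant
  (`TripleProductProperty.rotate`) and the volume is symmetric, the first-set form is equivalent.)

Composition: rotate the bumped set to the front, take `J, P` from the stub, cash the block with the
landed `stub_cash` (p87211: `UmvirateDescent` at `n' = n - t ∈ [n - √n, n)`).
-/

set_option linter.dupNamespace false

open Literature.Combinatorics.Additive
open Summit.MatrixMultiplication.MatrixMultiplication.Theses.SnSubsetDichotomy
open Summit.MatrixMultiplication.MatrixMultiplication.Theorems.JuntaBranch
open scoped Classical

namespace Summit.MatrixMultiplication.MatrixMultiplication.Cruxes.JuntaBranch.Sketch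

/-- **stub_alignedOrAbsent** (the card's transfer target `C⁺`, first-set form; REGISTERED STUB).
For all `ε, c > 0` there is `n₀` such that for `n ≥ n₀`, in every TPP triple `S, T, U ⊆ S_n` with
`(n!)^{3/2} e^{-c√n} ≤ |S||T||U|`, every block `(I → L)` of `S` of level `1 ≤ t ≤ √n` with
`n^{(1/2+ε)t} |S| < |S ∩ U_{I→L}| · n^{(t)}` admits injective `J, P : Fin t → Fin n` with
`e^{c+1} |S||T||U| ((n-t)!/n!)^{3/2} ≤ |S ∩ U_{I→L}| · |T ∩ U_{J→L}| · |U ∩ U_{P→L}|`. -/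
theorem stub_alignedOrAbsent :
    ∀ ε : ℝ, 0 < ε → ∀ c : ℝ, 0 < c → ∃ n₀ : ℕ, ∀ n ≥ n₀, ∀ S T U : Finset (Equiv.Perm (Fin n)),
      TripleProductProperty S T U →
      (n.factorial : ℝ) ^ ((3 : ℝ) / 2) * Real.exp (-(c * Real.sqrt (n : ℝ))) ≤
        ((S.card * T.card * U.card : ℕ) : ℝ) →
      ∀ t : ℕ, 1 ≤ t → (t : ℝ) ≤ Real.sqrt (n : ℝ) → ∀ I L : Fin t → Fin n,
        Function.Injective I → Function.Injective L →
        (n : ℝ) ^ ((1 / 2 + ε) * t) * (S.card : ℝ) <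
          ((S.filter (fun σ => ∀ k, σ (I k) = L k)).card : ℝ) * (n.descFactorial t : ℝ) →
        ∃ J P : Fin t → Fin n, Function.Injective J ∧ Function.Injective P ∧
          Real.exp (c + 1) * ((S.card * T.card * U.card : ℕ) : ℝ) *
              ((((n - t).factorial : ℕ) : ℝ) / (n.factorial : ℝ)) ^ ((3 : ℝ) / 2) ≤
            (((S.filter (fun σ => ∀ k, σ (I k) = L k)).card *
                (T.filter (fun σ => ∀ k, σ (J k) = L k)).card *
                (U.filter (fun σ => ∀ k, σ (P k) = L k)).card : ℕ) : ℝ) := by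
  sorry

/-- **Composition of the line `Sketch`**: `JuntaBranch` from the registered stub
`stub_alignedOrAbsent` (audit: concludes the crux by name).
Rotate the bumped set to the front (`TripleProductProperty.rotate`, the volume is symmetric), take
the partner sources `J, P` from the stub and cash the common-target block `(I→L, J→L, P→L)` with
`stub_cash` (landed, p87211) at `n' = n - t`. -/
theorem JuntaBranch_of : JuntaBranch := by
  have hAligned := stub_alignedOrAbsent
  intro ε hε c hc
  obtain ⟨n₀, h₀⟩ := hAligned ε hε c hc
  refine ⟨n₀, ?_⟩
  intro n hn S T U hTPP hLarge hBumpy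
  -- the core: a Large TPP triple whose FIRST set is bumpy is improved (stub + cash)
  have core : ∀ A B C : Finset (Equiv.Perm (Fin n)), TripleProductProperty A B C →
      (n.factorial : ℝ) ^ ((3 : ℝ) / 2) * Real.exp (-(c * Real.sqrt (n : ℝ))) ≤
        ((A.card * B.card * C.card : ℕ) : ℝ) →
      ∀ t : ℕ, 1 ≤ t → (t : ℝ) ≤ Real.sqrt (n : ℝ) → ∀ I L : Fin t → Fin n,
        Function.Injective I → Function.Injective L →
        (n : ℝ) ^ ((1 / 2 + ε) * t) * (A.card : ℝ) <
          ((A.filter (fun σ => ∀ k, σ (I k) = L k)).card : ℝ) * (n.descFactorial t : ℝ) →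
        ∃ n' : ℕ, (n : ℝ) - Real.sqrt (n : ℝ) ≤ (n' : ℝ) ∧ n' < n ∧
          ∃ S' T' U' : Finset (Equiv.Perm (Fin n')), TripleProductProperty S' T' U' ∧
            Real.exp (c + 1) * ((A.card * B.card * C.card : ℕ) : ℝ) *
                ((n'.factorial : ℝ) / (n.factorial : ℝ)) ^ ((3 : ℝ) / 2) ≤
              ((S'.card * T'.card * U'.card : ℕ) : ℝ) := by
    intro A B C hABC hLA t ht1 ht2 I L hI hL hbump
    obtain ⟨J, P, hJ, hP, hgain⟩ := h₀ n hn A B C hABC hLA t ht1 ht2 I L hI hL hbump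
    exact stub_cash n c A B C hABC t ht1 ht2 L I J P hL hI hJ hP hgain
  -- which set carries the bump: rotate it to the front
  obtain ⟨X, hX, t, ht1, ht2, I, L, hI, hL, hbump⟩ := hBumpy
  rcases hX with hXS | hXT | hXU
  · rw [hXS] at hbump
    exact core S T U hTPP hLarge t ht1 ht2 I L hI hL hbump
  · rw [hXT] at hbump
    have hvolT : T.card * U.card * S.card = S.card * T.card * U.card := by ring
    have hL1 : (n.factorial : ℝ) ^ ((3 : ℝ) / 2) * Real.exp (-(c * Real.sqrt (n : ℝ))) ≤
        ((T.card * U.card * S.card : ℕ) : ℝ) := by rw [hvolT]; exact hLarge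
    have h := core T U S hTPP.rotate hL1 t ht1 ht2 I L hI hL hbump
    rw [hvolT] at h
    exact h
  · rw [hXU] at hbump
    have hvolU : U.card * S.card * T.card = S.card * T.card * U.card := by ring
    have hL1 : (n.factorial : ℝ) ^ ((3 : ℝ) / 2) * Real.exp (-(c * Real.sqrt (n : ℝ))) ≤
        ((U.card * S.card * T.card : ℕ) : ℝ) := by rw [hvolU]; exact hLarge
    have h := core U S T hTPP.rotate.rotate hL1 t ht1 ht2 I L hI hL hbump
    rw [hvolU] at h
    exact h

end Summit.MatrixMultiplication.MatrixMultiplication.Cruxes.JuntaBranch.Sketch
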